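import Mathlib
import HarnessLib.Audit
import Summits.PneNP.PneNP.Theorems.PstarMemberKillCores

/-!
# The member with a PINNED shared literal: (M0) is the `p`-slope of the second reader (ROUND-24, O1; memo g28 §82)

FRONTIER range-avoidance ladder, rung F-N3, ROUND 24 (cell `pnp-ideate`, prover-2 memo `g28/O1-JOINS-g28.md` §82; census node
`PstarLocalGateBudgetAssembly.LocalMenuCriterionBoundGateBudget`; restricted-model proof complexity — nothing here bears on `P` versus `NP`).

`PstarSharedMemberKill` (memo g27 §74) kills a certificate at an `N`-member `e = (σ, p)` whose shared literal `σ` is UNPINNED.  This file treats the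
other regime: `σ` PINNED to `1` on the big slice `Ā = Sol(K ∖ e) ∩ {Γ₁ = b₁}` (by `PstarMemberKillJoins.true_on_sliceBut_of_block_join`: a one-block
value-`1` join through `σ` inside `K ∖ e` — on a cycle core the sibling's arc-with-folds).  Then `e` reads `x_u + x_v + x_p = y_e` on `Ā`, with `p`
PRIVATE (in no other output of `K`, unread by `Γ₁`), so flipping `p` moves between `A` and `Ā ∖ A`:

* `inSliceBut_update` / `flip_mem_slice` / `flip_not_mem_slice` — `Ā` is closed under changing `x_p`; from a point of `Ā ∖ A` the flip of `p` lands
  in `A`, from a point of `A` it leaves `A`;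
* **`slope_one_at_witness`** — (T3) on `A`: at every (M0)-witness `q ∈ Ā` (`Γ₂(q) = b₂`) the `p`-slope of `Γ₂` is `1`:
  `[p ∈ C₂] + starSum_{G₂}(p)(q) = 1`;
* **`witness_of_slope_one`** — conversely a point of `A` with `p`-slope `1` flips to an (M0)-witness: in the pinned regime (M0) at `e` is EXACTLY
  «the `p`-slope of `Γ₂` is not identically `0` on `A`»;
* **`false_of_pinned_sigma_slope_zero`**, `not_terminal(NC)_of_pinned_sigma_untouched` — so if `Γ₂` neither reads `p` linearly nor gates it
  (more generally: its `p`-slope vanishes on `Ā`), the pair is not a certificate.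

READING (with g27 §70 (c): an AND variable with private partners is never pinned to `0`): in the pinned regime the member `e` contributes exactly the
requirement «`Γ₂` touches `p`» — by a linear read (the released form) or by a gate — and nothing more; the census need not square this member.
-/

set_option linter.dupNamespace false -- `Summit.PneNP.PneNP.…`: summit = sub-problem name (D-0017 single-conjunct layout)

open Finset Literature.Computability.Complexity
open Summit.PneNP.PneNP.Theorems.PstarFibrePolys (bit bit_injective)
open Summit.PneNP.PneNP.Theorems.PstarSALevel (varSet)
open Summit.PneNP.PneNP.Theorems.PstarGapPeeling (eval_pure eval_update_of_not_mem)
open Summit.PneNP.PneNP.Theorems.PstarGapOneAll (gval)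
open Summit.PneNP.PneNP.Theorems.PstarGConstraint (gval_update_of_forall_ne)
open Summit.PneNP.PneNP.Theorems.PstarCoreBoundTargets (Terminal)
open Summit.PneNP.PneNP.Theorems.PstarUnion (SatPair)
open Summit.PneNP.PneNP.Theorems.PstarUnionCovers (TerminalNC)
open Summit.PneNP.PneNP.Theorems.PstarMenuLocality (starSum bit_gval_flip starSum_eq_zero)
open Summit.PneNP.PneNP.Theorems.PstarLiteralPinning (Through InSlice)
open Summit.PneNP.PneNP.Theorems.PstarDirtyMemberSquare (InSliceBut inSlice_iff)
open Summit.PneNP.PneNP.Theorems.PstarMemberKillCores (T3_of_not_satPair exists_sliceBut_of_satPair_erase)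

namespace Summit.PneNP.PneNP.Theorems.PstarPinnedSigmaMember

variable {n m : ℕ} {I : LocalMap 4 n m} {y : Fin m → Bool} {K : Finset (Fin m)} {w₁ w₂ : Finset (Fin n) × Finset (Fin m) × Bool}
  {e : Fin m} {σ p : Fin n}

section Main

/-- `σ ≠ p`. -/
theorem sigma_ne (hI : I.IsPure xorAndPred) (hse : (I.vars e 2 = σ ∧ I.vars e 3 = p) ∨ (I.vars e 2 = p ∧ I.vars e 3 = σ)) : σ ≠ p := by
  have h : I.vars e 2 ≠ I.vars e 3 := fun h => absurd (hI.2 e h) (by decide)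
  rcases hse with ⟨a, b⟩ | ⟨a, b⟩
  · rw [← a, ← b]; exact h
  · rw [← a, ← b]; exact h.symm

/-- **`Ā` is closed under changing `x_p`** (privacy of `p` on the `K ∖ e` and `Γ₁` side). -/
theorem inSliceBut_update (hpK : ∀ j ∈ K, j ≠ e → p ∉ varSet I j) (hpC₁ : p ∉ w₁.1) (hpG₁ : ∀ g ∈ w₁.2.1, I.vars g 2 ≠ p ∧ I.vars g 3 ≠ p)
    {q : Fin n → Bool} (hq : InSliceBut I y K e w₁ q) (b : Bool) : InSliceBut I y K e w₁ (Function.update q p b) :=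
  ⟨fun j hj hje => by rw [eval_update_of_not_mem I j q (hpK j hj hje) b]; exact hq.1 j hj hje,
    by rw [gval_update_of_forall_ne I q hpC₁ hpG₁]; exact hq.2⟩

/-- Where `σ = 1` the member reads `x_u ⊕ x_v ⊕ x_p`. -/
theorem eval_e_of_sigma (hI : I.IsPure xorAndPred) (hse : (I.vars e 2 = σ ∧ I.vars e 3 = p) ∨ (I.vars e 2 = p ∧ I.vars e 3 = σ))
    {q : Fin n → Bool} (hqσ : q σ = true) : I.eval q e = xor (xor (q (I.vars e 0)) (q (I.vars e 1))) (q p) := by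
  rw [eval_pure I hI]
  rcases hse with ⟨a, b⟩ | ⟨a, b⟩
  · rw [a, b, hqσ, Bool.true_and]
  · rw [a, b, hqσ, Bool.and_true]

variable (hI : I.IsPure xorAndPred) (he : e ∈ K) (hse : (I.vars e 2 = σ ∧ I.vars e 3 = p) ∨ (I.vars e 2 = p ∧ I.vars e 3 = σ))
  (hpe : I.vars e 0 ≠ p ∧ I.vars e 1 ≠ p) (hpK : ∀ j ∈ K, j ≠ e → p ∉ varSet I j) (hpC₁ : p ∉ w₁.1)
  (hpG₁ : ∀ g ∈ w₁.2.1, I.vars g 2 ≠ p ∧ I.vars g 3 ≠ p) (hσ : ∀ q, InSliceBut I y K e w₁ q → q σ = true)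
include hI he hse hpe hpK hpC₁ hpG₁ hσ

omit he in
/-- Flipping `p` flips the member's value on `Ā`. -/
theorem eval_e_flip {q : Fin n → Bool} (hq : InSliceBut I y K e w₁ q) :
    I.eval (Function.update q p (!q p)) e = !I.eval q e := by
  have hq' := inSliceBut_update hpK hpC₁ hpG₁ hq (!q p)
  rw [eval_e_of_sigma hI hse (hσ _ hq'), eval_e_of_sigma hI hse (hσ _ hq),
    Function.update_of_ne hpe.1, Function.update_of_ne hpe.2, Function.update_self]
  cases q (I.vars e 0) <;> cases q (I.vars e 1) <;> cases q p <;> rfl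

/-- **From `Ā ∖ A` the flip of `p` lands in `A`.** -/
theorem flip_mem_slice {q : Fin n → Bool} (hq : InSliceBut I y K e w₁ q) (hqe : I.eval q e ≠ y e) :
    InSlice I y K w₁ (Function.update q p (!q p)) := by
  refine (inSlice_iff he).2 ⟨inSliceBut_update hpK hpC₁ hpG₁ hq _, ?_⟩
  rw [eval_e_flip hI hse hpe hpK hpC₁ hpG₁ hσ hq]
  revert hqe; cases I.eval q e <;> cases y e <;> decide

/-- **From `A` the flip of `p` leaves `A`** (it breaks `e`). -/
theorem flip_not_mem_slice {z : Fin n → Bool} (hz : InSlice I y K w₁ z) : ¬ InSlice I y K w₁ (Function.update z p (!z p)) := by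
  intro hz'
  have h1 := ((inSlice_iff he).1 hz').2
  rw [eval_e_flip hI hse hpe hpK hpC₁ hpG₁ hσ ((inSlice_iff he).1 hz).1, ((inSlice_iff he).1 hz).2] at h1
  revert h1; cases y e <;> decide

/-- **THE `p`-SLOPE IS ONE AT EVERY (M0)-WITNESS.**  (T3) on `A`; `q ∈ Ā` with `Γ₂(q) = b₂`.  Then `[p ∈ C₂] + starSum_{G₂}(p)(q) = 1`. -/
theorem slope_one_at_witness (hT3 : ∀ z, InSlice I y K w₁ z → gval I w₂.1 w₂.2.1 z ≠ w₂.2.2) {q : Fin n → Bool}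
    (hq : InSliceBut I y K e w₁ q) (hq₂ : gval I w₂.1 w₂.2.1 q = w₂.2.2) :
    (if p ∈ w₂.1 then (1 : ZMod 2) else 0) + starSum I w₂.2.1 p q = 1 := by
  have hqA : ¬ InSlice I y K w₁ q := fun h => hT3 q h hq₂
  have hqe : I.eval q e ≠ y e := fun h => hqA ((inSlice_iff he).2 ⟨hq, h⟩)
  have hflip := flip_mem_slice hI he hse hpe hpK hpC₁ hpG₁ hσ hq hqe
  have hne := hT3 _ hflip
  have hb := bit_gval_flip I hI w₂.1 w₂.2.1 q p
  rw [hq₂] at hb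
  -- `Γ₂(q ⊕ e_p) ≠ b₂` while `Γ₂(q) = b₂`: the difference is `1`
  have hdiff : bit (gval I w₂.1 w₂.2.1 (Function.update q p (!q p))) + bit w₂.2.2 = 1 := by
    revert hne; cases gval I w₂.1 w₂.2.1 (Function.update q p (!q p)) <;> cases w₂.2.2 <;> decide
  have h2 : ∀ x : ZMod 2, x + x = 0 := by decide
  linear_combination hdiff - hb - h2 (bit w₂.2.2)

omit hse hpe hσ in
/-- **A SLICE POINT WITH `p`-SLOPE ONE FLIPS TO AN (M0)-WITNESS.**  (T3) on `A`; `z ∈ A` with `[p ∈ C₂] + starSum(p)(z) = 1`: then `z ⊕ e_p ∈ Ā` and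
`Γ₂(z ⊕ e_p) = b₂`. -/
theorem witness_of_slope_one (hT3 : ∀ z, InSlice I y K w₁ z → gval I w₂.1 w₂.2.1 z ≠ w₂.2.2) {z : Fin n → Bool} (hz : InSlice I y K w₁ z)
    (hslope : (if p ∈ w₂.1 then (1 : ZMod 2) else 0) + starSum I w₂.2.1 p z = 1) :
    InSliceBut I y K e w₁ (Function.update z p (!z p)) ∧ gval I w₂.1 w₂.2.1 (Function.update z p (!z p)) = w₂.2.2 := by
  refine ⟨inSliceBut_update hpK hpC₁ hpG₁ ((inSlice_iff he).1 hz).1 _, ?_⟩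
  have hne := hT3 z hz
  have hb := bit_gval_flip I hI w₂.1 w₂.2.1 z p
  rw [hslope] at hb
  apply bit_injective
  have hz2 : bit (gval I w₂.1 w₂.2.1 z) + bit w₂.2.2 = 1 := by
    revert hne; cases gval I w₂.1 w₂.2.1 z <;> cases w₂.2.2 <;> decide
  have h2 : ∀ x : ZMod 2, x + x = 0 := by decide
  linear_combination hb - hz2 + h2 (bit (gval I w₂.1 w₂.2.1 z))

/-- **PINNED `σ` AND VANISHING `p`-SLOPE KILL THE CERTIFICATE**: if the `p`-slope of `Γ₂` is `0` at every point of `Ā`, then (T3) together with (M0)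
at `e` is contradictory. -/
theorem false_of_pinned_sigma_slope_zero (hslope : ∀ q, InSliceBut I y K e w₁ q → (if p ∈ w₂.1 then (1 : ZMod 2) else 0) + starSum I w₂.2.1 p q = 0)
    (hT3 : ¬ SatPair I y K w₁ w₂) (hM0 : SatPair I y (K.erase e) w₁ w₂) : False := by
  obtain ⟨q, hq, hq₂⟩ := exists_sliceBut_of_satPair_erase hM0
  have h1 := slope_one_at_witness hI he hse hpe hpK hpC₁ hpG₁ hσ (T3_of_not_satPair hT3) hq hq₂
  rw [hslope q hq] at h1
  exact zero_ne_one h1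

/-- **In particular `Γ₂` must TOUCH `p`**: if `p ∉ C₂` and no monomial of `Γ₂` passes through `p`, (T3) + (M0) at `e` fail. -/
theorem false_of_pinned_sigma_untouched (hpC₂ : p ∉ w₂.1) (hpG₂ : ∀ g ∈ w₂.2.1, I.vars g 2 ≠ p ∧ I.vars g 3 ≠ p)
    (hT3 : ¬ SatPair I y K w₁ w₂) (hM0 : SatPair I y (K.erase e) w₁ w₂) : False :=
  false_of_pinned_sigma_slope_zero hI he hse hpe hpK hpC₁ hpG₁ hσ
    (fun q _ => by rw [if_neg hpC₂, starSum_eq_zero I hpG₂ q, add_zero]) hT3 hM0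

/-- `Terminal` version of `false_of_pinned_sigma_untouched`. -/
theorem not_terminal_of_pinned_sigma_untouched {r : ℕ} (hpC₂ : p ∉ w₂.1) (hpG₂ : ∀ g ∈ w₂.2.1, I.vars g 2 ≠ p ∧ I.vars g 3 ≠ p) :
    ¬ Terminal I r y K w₁ w₂ := fun ht =>
  false_of_pinned_sigma_untouched hI he hse hpe hpK hpC₁ hpG₁ hσ hpC₂ hpG₂ ht.2.2.2.2.2.2.1 (ht.2.2.2.2.2.2.2 e he)

/-- `TerminalNC` version of `false_of_pinned_sigma_untouched`. -/
theorem not_terminalNC_of_pinned_sigma_untouched {r : ℕ} (hpC₂ : p ∉ w₂.1) (hpG₂ : ∀ g ∈ w₂.2.1, I.vars g 2 ≠ p ∧ I.vars g 3 ≠ p) :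
    ¬ TerminalNC I r y K w₁ w₂ := fun ht =>
  false_of_pinned_sigma_untouched hI he hse hpe hpK hpC₁ hpG₁ hσ hpC₂ hpG₂ ht.2.2.2.2.2.1 (ht.2.2.2.2.2.2 e he)

/-- **(M0) AT `e` IS EQUIVALENT TO A NON-VANISHING `p`-SLOPE ON `A`** (given (T3)): the pinned member contributes exactly this requirement. -/
theorem satPair_erase_iff_slope (hT3 : ¬ SatPair I y K w₁ w₂) :
    SatPair I y (K.erase e) w₁ w₂ ↔ ∃ z, InSlice I y K w₁ z ∧ (if p ∈ w₂.1 then (1 : ZMod 2) else 0) + starSum I w₂.2.1 p z = 1 := by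
  have hT3' := T3_of_not_satPair hT3
  constructor
  · intro hM0
    obtain ⟨q, hq, hq₂⟩ := exists_sliceBut_of_satPair_erase hM0
    have hqe : I.eval q e ≠ y e := fun h => hT3' q ((inSlice_iff he).2 ⟨hq, h⟩) hq₂
    refine ⟨_, flip_mem_slice hI he hse hpe hpK hpC₁ hpG₁ hσ hq hqe, ?_⟩
    -- the slope does not see `x_p` itself (no monomial `{p, p}`; `p`'s own coordinate is not a partner of `p`)
    have hs : starSum I w₂.2.1 p (Function.update q p (!q p)) = starSum I w₂.2.1 p q := by
      unfold PstarMenuLocality.starSum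
      refine sum_congr rfl fun g _ => ?_
      have h23 : I.vars g 2 ≠ I.vars g 3 := fun h => absurd (hI.2 g h) (by decide)
      by_cases h2 : I.vars g 2 = p
      · have h3 : I.vars g 3 ≠ p := fun h => h23 (h2.trans h.symm)
        rw [if_pos h2, if_pos h2, Function.update_of_ne h3]
        by_cases h3' : I.vars g 3 = p
        · exact absurd h3' h3
        · rw [if_neg h3', if_neg h3']
      · rw [if_neg h2, if_neg h2]
        by_cases h3 : I.vars g 3 = p
        · rw [if_pos h3, if_pos h3, Function.update_of_ne h2]
        · rw [if_neg h3, if_neg h3]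
    rw [hs]
    exact slope_one_at_witness hI he hse hpe hpK hpC₁ hpG₁ hσ hT3' hq hq₂
  · rintro ⟨z, hz, hslope⟩
    obtain ⟨hq, hq₂⟩ := witness_of_slope_one hI he hpK hpC₁ hpG₁ hT3' hz hslope
    exact ⟨_, fun j hj => hq.1 j (mem_of_mem_erase hj) (ne_of_mem_erase hj), hq.2, hq₂⟩

end Main

end Summit.PneNP.PneNP.Theorems.PstarPinnedSigmaMember
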